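import Mathlib.Analysis.Real.Sqrt
import Literature.Analysis.ValidatedNumerics.Certificate
import HarnessLib

/-!
# Kernel-checked numerical certificates: glue for the `γ = 5/3` barrier files

Small interface on top of `Literature.Analysis.ValidatedNumerics.Certificate` (rational interval
arithmetic evaluated in the kernel by `decide +kernel`): a checked `BoundClaim` is turned into a
real inequality at a point given as a *list* of real numbers (`pt`), the box-membership
obligation being a `List.Forall₂` of individual enclosures. This is the counterpart of the
interval-arithmetic (Arb) computations of Buckmaster–Cao-Labora–Gómez-Serrano, App. B: every
numerical inequality used by the barrier arguments is a `BoundClaim` accepted by the checker.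

[cite: BuckmasterCaolaboraGomezserrano2025, Appendix B (computer-assisted estimates)]
-/

noncomputable section

open Set

namespace Literature.Analysis.FluidPDE

namespace BuckmasterCaolaboraGomezserrano2025

namespace Monatomic

namespace Cert

open Literature.Analysis.ValidatedNumerics NonemptyInterval

/-- The evaluation point of a certificate, given as a list (variables past the end are `0`).
[folklore] -/
def pt (l : List ℝ) : ℕ → ℝ := fun i => l.getD i 0

/-- [folklore] -/
@[simp] theorem pt_cons_zero (a : ℝ) (l : List ℝ) : pt (a :: l) 0 = a := rfl

/-- [folklore] -/
@[simp] theorem pt_cons_succ (a : ℝ) (l : List ℝ) (n : ℕ) : pt (a :: l) (n + 1) = pt l n := rfl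

/-- [folklore] -/
@[simp] theorem pt_nil (n : ℕ) : pt [] n = 0 := rfl

/-- Box membership of a list point from the memberships of its entries. [folklore] -/
theorem forall_mem_boxAt {l : List ℝ} {boxes : List (NonemptyInterval ℚ)}
    (h : List.Forall₂ (fun (v : ℝ) (I : NonemptyInterval ℚ) => v ∈ I.ratCast ℝ) l boxes)
    (e : ArithExpr) (b : ℚ) : ∀ i, pt l i ∈ ((⟨e, boxes, b⟩ : BoundClaim).boxAt i).ratCast ℝ := by
  intro i
  unfold BoundClaim.boxAt
  simp only
  induction h generalizing i with
  | nil =>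
    simp only [List.getD_nil, pt_nil, ratCast_pure, Rat.cast_zero]
    exact NonemptyInterval.mem_pure_self _
  | @cons v I l' boxes' hv _ ih =>
    cases i with
    | zero => simpa using hv
    | succ n => simpa using ih n

/-- **Using a checked bound claim at a list point.** [cite: Moore1966, Theorem 3.1] -/
theorem eval_le_of_check {e : ArithExpr} {boxes : List (NonemptyInterval ℚ)} {b : ℚ} {prec : ℕ}
    (hc : boundVerifier.check ⟨e, boxes, b⟩ prec = true) {l : List ℝ}
    (hl : List.Forall₂ (fun (v : ℝ) (I : NonemptyInterval ℚ) => v ∈ I.ratCast ℝ) l boxes) :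
    e.eval (pt l) ≤ b :=
  (BoundClaim.holds_of_check ⟨e, boxes, b⟩ prec hc) (pt l) (forall_mem_boxAt hl e b)

/-- Membership in a literal rational interval from real bounds. [folklore] -/
theorem mem_mk {lo hi : ℚ} (h : lo ≤ hi) {v : ℝ} (h1 : (lo : ℝ) ≤ v) (h2 : v ≤ hi) :
    v ∈ (⟨(lo, hi), h⟩ : NonemptyInterval ℚ).ratCast ℝ :=
  mem_ratCast_iff.mpr ⟨h1, h2⟩

/-- Membership of a real number in the interval of its known bounds (packaged form). [folklore] -/
theorem mem_mk' {lo hi : ℚ} (h : lo ≤ hi) {v : ℝ} (hv : (lo : ℝ) ≤ v ∧ v ≤ hi) :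
    v ∈ (⟨(lo, hi), h⟩ : NonemptyInterval ℚ).ratCast ℝ :=
  mem_ratCast_iff.mpr hv

/-- A rational point lies in its point interval. [folklore] -/
theorem cast_mem_mk {lo hi : ℚ} (h : lo ≤ hi) {q : ℚ} (h1 : lo ≤ q) (h2 : q ≤ hi) :
    (q : ℝ) ∈ (⟨(lo, hi), h⟩ : NonemptyInterval ℚ).ratCast ℝ :=
  mem_ratCast_iff.mpr ⟨Rat.cast_le.mpr h1, Rat.cast_le.mpr h2⟩

/-- Bounds of a quotient with positive denominator from two linear inequalities. [folklore] -/
theorem div_bounds_of_pos {n c lo hi : ℝ} (hc : 0 < c) (h1 : lo * c ≤ n) (h2 : n ≤ hi * c) :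
    lo ≤ n / c ∧ n / c ≤ hi :=
  ⟨(le_div_iff₀ hc).mpr h1, (div_le_iff₀ hc).mpr h2⟩

/-- Bounds of a quotient with negative denominator. [folklore] -/
theorem div_bounds_of_neg {n c lo hi : ℝ} (hc : c < 0) (h1 : n ≤ lo * c) (h2 : hi * c ≤ n) :
    lo ≤ n / c ∧ n / c ≤ hi :=
  ⟨(le_div_iff_of_neg hc).mpr h1, (div_le_iff_of_neg hc).mpr h2⟩

/-- Square-root enclosure from squares. [folklore] -/
theorem sqrt_bounds {d lo hi : ℝ} (h1 : lo ^ 2 ≤ d) (h2 : d ≤ hi ^ 2) (hhi : 0 ≤ hi) :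
    lo ≤ Real.sqrt d ∧ Real.sqrt d ≤ hi :=
  ⟨Real.le_sqrt_of_sq_le h1, Real.sqrt_le_iff.mpr ⟨hhi, h2⟩⟩

end Cert

end Monatomic

end BuckmasterCaolaboraGomezserrano2025

end Literature.Analysis.FluidPDE
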